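/-
Origin: expansion seat `planner-pub-hodgecm-mc-axioms-1-g14-0`, handover #W184 2026-08-20T15:53:55Z md5 2d155a9139df (PKG 0edfcfa15274 → 2d155a9139df; 219 l.; MECHANICAL (iib-R) rewrite v3.1 of the PKG file as it stands (56 token edits; rules R1x1+RX[h₂']x55)) (`HOME/mc/pub-hodgecm-mc-axioms-1-g14/revendor/kit-r55/stage55/HodgeCM/Model/Sanity/DegenerateClosureOR21AE.lean`, md5 2d155a9139df, 219 lines);
landed by the gen-22 packager (p-g22) in gate run 55 REPLACES the earlier landed copy of `HodgeCM/Model/Sanity/DegenerateClosureOR21AE.lean` (seat copy carried the packager Origin header of an earlier run (stripped)).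
-/
/-
Origin: SANITY lane `planner-pub-hodgecm-mc-sanity-1-g11-0` (unit pub-hodgecm-mc-sanity-1-g11, gen 11 of mc-sanity-1,
node SAN-25), 2026-08-20.  NEW additive KERNEL leaf `HodgeCM/Model/Sanity/DegenerateClosureOR21AE.lean` over the
RUN-41 rows `HodgeCM.Model.E2InstanceOR21AE` (glue-1 #381 `perL_picardCM_r21AEO`; imports #380 `E2InstanceOR20AE`
`perL_picardCM_r20AEO`, hence the oriented chain #372–#379 and #367) — the ORIENTED E: the global sign-recipe bit
`h : Bool` replaced by a bit PER UNIVERSE `hb : ∀ L : CMField, (L →+* ℂ) → Bool`, every binder type VERBATIM the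
un-oriented one with `h ↦ hb L ι₁` — and the installed RUN-40 leaf `HodgeCM.Model.Sanity.CommonReflexDegenerate`
(SAN-22; brings SAN-20 / SAN-21 and every degenerate discharger of the lane).  Imported by nothing.
CONDITIONAL ROW: tabled only together with #380 / #381; INSTALL AFTER #381.
KERNEL: 0 records, 0 `Prop` definitions, 0 hypotheses minted, nothing cited, no instances; ONE `abbrev` of a TYPE
(`CdegSO`, the oriented reading of SAN-15's `CdegS`).
Expected `#print axioms`: ⊆ {propext, Classical.choice, Quot.sound}.
-/
import Summits.HodgeConjecture.HodgeCM.Model.E2InstanceOR21AE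
import Summits.HodgeConjecture.HodgeCM.Model.Sanity.CommonReflexDegenerate

/-!
# SAN-25 — the DEGENERATE CLOSURE of the ORIENTED E (R20AEO / R21AEO: sign-recipe bit per universe)

MODEL-CONSTRUCTION sub-cell, SANITY lane (unit `pub-hodgecm-mc-sanity-1-g11`, node SAN-25).  KERNEL only; census leaf.

glue-1's oriented family (RUN 41, #372–#381; lead ruling (ORIENT-h), theta-3 FLAG (5)) re-reads the end state over a
FAMILY of theta models indexed by the universe `(L, ι₁)`: the recipe bit of E becomes `hb L ι₁` instead of one global
`h : Bool`.  `Model.perL_picardCM_r20AEO` (#380) / `Model.perL_picardCM_r21AEO` (#381) have the 15 binder groups of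
R20AE / R21AE with `h ↦ hb L ι₁` inside every model term, and the same conclusion `(picardCMUniverse …).PerL`.

Every degenerate discharger of this lane (SAN-10 … SAN-24) is stated PER CONTEXT with the bit `h` an explicit
argument, so the oriented E closes over the degenerate inhabitants `S := degS`, `W := zeroSK ∘ W` by the SAME eight
bullets evaluated at `h := hb L ι₁`:

* `CdegSO` — the oriented reading of SAN-15's data binder type `CdegS` (E's group `C` at `S := degS`, `W := zeroSK ∘ W`,
  bit `hb L ι₁`); `cdegS_eq_cdegSO`: at a constant bit it IS `CdegS` (`rfl`).  `isEmpty_cdegSO_fibre`: its fibre over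
  any anisotropic context is empty (SAN-10b), whatever the bit.
* `perL_r20AEO_degS` / `perL_r21AEO_degS` — the oriented E (either row-9 typing) at `S := degS`, `W := zeroSK ∘ W`
  closes `PerL` from `hb hA W μ hR` modulo the ONE data binder `CdegSO`; bullets: `hsmall` SAN-20 `hsmall_degS` (resp.
  `hΘ` SAN-22 `hTheta_degS`) · `hT` SAN-17a · `hpd` / along-form `hk` vacuous over the empty fibre · `gen12` `gen12_degS'`
  · `real34` / `hyp12` / `hyp34` SAN-12 — each at `h := hb L ι₁`.
* `perL_r21AEO_degS_eq` — the two oriented closures are one proposition (`rfl`).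
* `perL_r21AEO_of_noGoodSexticO` — so the oriented E closes from toys EXACTLY modulo the oriented vacuity residual
  «no universe `(L, ι₁)` carries an anisotropic good sextic context for the model with bit `hb L ι₁`» (stated inline;
  for a constant bit it is SAN-15's `NoGoodSextic`, refuted by SAN-15b — `perL_r21AEO_const_of_noGoodSextic`).

READING (census, MODEL-N ±0; nothing here is a defect claim): orienting the bit changes WHICH honest pin E reads at
each universe, not the shape of any row; over degenerate data the census of record is UNCHANGED — every binder of the
oriented E but `C` is free and `C` (`CdegSO`, fibrewise empty) is the sole gatekeeper; toy-visible binders 15 → 15.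
-/

set_option autoImplicit false

noncomputable section

namespace HodgeCM
namespace Model
namespace Sanity

open HodgeCM.Universe (SideData ThetaModel AdelicThetaCore AdelicTorusCore)
open HodgeCM.PerL34 HodgeCM.PerL34.ArchC
open Literature.AlgebraicGeometry.HodgeTheory Literature.NumberTheory.Automorphic.PicardCM
open Literature.NumberTheory.Transcendental (Arapura2012_Cor_15_4_6)
open Literature.AlgebraicGeometry.ShimuraVarieties
open HodgeCM.Model.ThetaSpace
open HodgeCM.Model.SupplyResidual

variable (hHD : exists_isReal_hodgeModel) (hI : hodgePQ_independent_of_hodgeModel)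
  (h₁ : BallQuotientUniformised)

/-- The ORIENTED data binder `C` of E read at the degenerate inhabitants `S := degS`, `W := zeroSK ∘ W` — SAN-15's
`CdegS` with the recipe bit `hb L ι₁` per universe (verbatim shape of `Model.perL_picardCM_r20AEO`'s group `C`). -/
abbrev CdegSO (h₃ : CMAbelianVarietyRealised) (hb : ∀ L : CMField, (L →+* ℂ) → Bool) (hA : Arapura2012_Cor_15_4_6)
    (W : ∀ {L : CMField} {ι₁ : L →+* ℂ} (V : HermSpace3 L ι₁) (c : SeesawCtx L), WmInput V c.D)
    (μ : ∀ {L : CMField}, SeesawCtx L → Fin 4 → NumberField.InfinitePlace L → ℤ) : Type 1 :=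
  ∀ {L : CMField} {ι₁ : L →+* ℂ} (V : HermSpace3 L ι₁) (c : SeesawCtx L) (hV : IsAnisotropic L V.Hm),
    (thetaModelOf hHD hI h₁ h₃ (hb L ι₁) (embOf hHD hI h₁ h₃) (coverOf hHD hI h₁ h₃ hA)
      (wmOfInput fun V c => (W V c).zeroSK)
      (thetaOf _ (thetaClassInputOf _ (fun V c => thetaSpaceInputOf hHD hI h₁ h₃ degS V c))) (d12Of μ)
      (d34Of μ)).GoodCtx ι₁ c →
    Module.finrank ℚ c.K = 6 → ∀ k : Fin 4, k = 0 ∨ k = 1 → ∀ N : ℕ, 0 < N →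
      ArchKTypeData (thetaSpaceInputIn hHD hI h₁ h₃ (degS V c) hV) k N

/-- At a CONSTANT bit the oriented data binder type is SAN-15's `CdegS`. -/
theorem cdegS_eq_cdegSO (h₃ : CMAbelianVarietyRealised) (h : Bool) (hA : Arapura2012_Cor_15_4_6)
    (W : ∀ {L : CMField} {ι₁ : L →+* ℂ} (V : HermSpace3 L ι₁) (c : SeesawCtx L), WmInput V c.D)
    (μ : ∀ {L : CMField}, SeesawCtx L → Fin 4 → NumberField.InfinitePlace L → ℤ) :
    CdegS hHD hI h₁ h₃ h hA W μ = CdegSO hHD hI h₁ h₃ (fun _ _ => h) hA W μ :=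
  rfl

/-- The fibre of the oriented data binder over an anisotropic context is EMPTY, whatever the bit (SAN-10b). -/
theorem isEmpty_cdegSO_fibre (h₃ : CMAbelianVarietyRealised) {L : CMField} {ι₁ : L →+* ℂ} (V : HermSpace3 L ι₁)
    (c : SeesawCtx L) (hV : IsAnisotropic L V.Hm) :
    IsEmpty (∀ k : Fin 4, k = 0 ∨ k = 1 → ∀ N : ℕ, 0 < N →
      ArchKTypeData (thetaSpaceInputIn hHD hI h₁ h₃ (degS V c) hV) k N) :=
  isEmpty_C_fibre_degS hHD hI h₁ h₃ V c hV

/-- **The oriented E R20AEO over the degenerate data closes PerL modulo the single binder `C`** — the eight Prop-row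
discharges of SAN-23 `perL_r20AE_degS`, each evaluated at the bit `h := hb L ι₁` of its own universe. -/
theorem perL_r20AEO_degS (h₃' : CMAbelianVarietyEigenbasisRealised) (hb : ∀ L : CMField, (L →+* ℂ) → Bool)
    (hA : Arapura2012_Cor_15_4_6)
    (W : ∀ {L : CMField} {ι₁ : L →+* ℂ} (V : HermSpace3 L ι₁) (c : SeesawCtx L), WmInput V c.D)
    (μ : ∀ {L : CMField}, SeesawCtx L → Fin 4 → NumberField.InfinitePlace L → ℤ)
    (hR : DeligneMilne1982_Thm_6_20_full)
    (C : CdegSO hHD hI h₁ (cmAbelianVarietyRealised_of_eigenbasis hHD hI h₃') hb hA W μ) :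
    (picardCMUniverse hHD hI h₁ (cmAbelianVarietyRealised_of_eigenbasis hHD hI h₃')).PerL := by
  refine perL_picardCM_r20AEO hHD hI h₁ h₃' hb hA (fun V c => (W V c).zeroSK) degS μ hR
    ?_ C ?_ ?_ ?_ ?_ ?_ ?_ ?_
  · -- `hsmall` at the bit `hb L ι₁`
    intro L ι₁ V c hc hK i
    exact hsmall_degS hHD hI h₁ _ (hb L ι₁) (embOf hHD hI h₁ _) (coverOf hHD hI h₁ _ hA)
      (wmOfInput fun V c => (W V c).zeroSK) (d12Of μ) (d34Of μ) V c hc hK i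
  · -- `hT`
    intro L ι₁ V c k N
    exact isThetaArchContinuous_degS V c k N
  · -- `hpd`
    intro L ι₁ V c hV hc h6 k hk N hN
    exact ((isEmpty_C_fibre_degS hHD hI h₁ _ V c hV).false (C V c hV hc h6)).elim
  · -- `hk` (along form)
    intro L ι₁ V c hV hc h6 k hk N hN p
    exact ((isEmpty_C_fibre_degS hHD hI h₁ _ V c hV).false (C V c hV hc h6)).elim
  · -- `gen12`
    intro L ι₁ V c
    exact gen12_degS' hHD hI h₁ _ (hb L ι₁) (embOf hHD hI h₁ _) (coverOf hHD hI h₁ _ hA)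
      (fun V c => (W V c).zeroSK) μ V c
  · -- `real34`
    intro L ι₁ V c _ _
    exact real34_zeroSK (embOf hHD hI h₁ _) (coverOf hHD hI h₁ _ hA) W _ (hb L ι₁) (d12Of μ) (d34Of μ) V c
  · -- `hyp12`
    intro L ι₁ V c _ _
    exact hyp12_zeroSK (embOf hHD hI h₁ _) (coverOf hHD hI h₁ _ hA) W _ (hb L ι₁) _ _ _ V c
  · -- `hyp34`
    intro L ι₁ V c _ _
    exact hyp34_zeroSK (embOf hHD hI h₁ _) (coverOf hHD hI h₁ _ hA) W _ (hb L ι₁) _ _ _ V c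

/-- **The oriented E R21AEO (row 9 `hΘ`) over the degenerate data closes PerL modulo the single binder `C`** —
group 7 by SAN-22 `hTheta_degS` at the bit `hb L ι₁`, the rest as `perL_r20AEO_degS`. -/
theorem perL_r21AEO_degS (h₃' : CMAbelianVarietyEigenbasisRealised) (hb : ∀ L : CMField, (L →+* ℂ) → Bool)
    (hA : Arapura2012_Cor_15_4_6)
    (W : ∀ {L : CMField} {ι₁ : L →+* ℂ} (V : HermSpace3 L ι₁) (c : SeesawCtx L), WmInput V c.D)
    (μ : ∀ {L : CMField}, SeesawCtx L → Fin 4 → NumberField.InfinitePlace L → ℤ)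
    (hR : DeligneMilne1982_Thm_6_20_full)
    (C : CdegSO hHD hI h₁ (cmAbelianVarietyRealised_of_eigenbasis hHD hI h₃') hb hA W μ) :
    (picardCMUniverse hHD hI h₁ (cmAbelianVarietyRealised_of_eigenbasis hHD hI h₃')).PerL := by
  refine perL_picardCM_r21AEO hHD hI h₁ h₃' hb hA (fun V c => (W V c).zeroSK) degS μ hR
    ?_ C ?_ ?_ ?_ ?_ ?_ ?_ ?_
  · -- `hΘ` (row 9 re-sourced) at the bit `hb L ι₁` — SAN-22
    intro L ι₁ V c _ _ i
    exact hTheta_degS hHD hI h₁ _ (hb L ι₁) (embOf hHD hI h₁ _) (coverOf hHD hI h₁ _ hA)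
      (wmOfInput fun V c => (W V c).zeroSK) (d12Of μ) (d34Of μ) V c i
  · -- `hT`
    intro L ι₁ V c k N
    exact isThetaArchContinuous_degS V c k N
  · -- `hpd`
    intro L ι₁ V c hV hc h6 k hk N hN
    exact ((isEmpty_C_fibre_degS hHD hI h₁ _ V c hV).false (C V c hV hc h6)).elim
  · -- `hk` (along form)
    intro L ι₁ V c hV hc h6 k hk N hN p
    exact ((isEmpty_C_fibre_degS hHD hI h₁ _ V c hV).false (C V c hV hc h6)).elim
  · -- `gen12`
    intro L ι₁ V c
    exact gen12_degS' hHD hI h₁ _ (hb L ι₁) (embOf hHD hI h₁ _) (coverOf hHD hI h₁ _ hA)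
      (fun V c => (W V c).zeroSK) μ V c
  · -- `real34`
    intro L ι₁ V c _ _
    exact real34_zeroSK (embOf hHD hI h₁ _) (coverOf hHD hI h₁ _ hA) W _ (hb L ι₁) (d12Of μ) (d34Of μ) V c
  · -- `hyp12`
    intro L ι₁ V c _ _
    exact hyp12_zeroSK (embOf hHD hI h₁ _) (coverOf hHD hI h₁ _ hA) W _ (hb L ι₁) _ _ _ V c
  · -- `hyp34`
    intro L ι₁ V c _ _
    exact hyp34_zeroSK (embOf hHD hI h₁ _) (coverOf hHD hI h₁ _ hA) W _ (hb L ι₁) _ _ _ V c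

/-- The two oriented closures over the degenerate data are ONE proposition (proof irrelevance made explicit). -/
theorem perL_r21AEO_degS_eq (h₃' : CMAbelianVarietyEigenbasisRealised) (hb : ∀ L : CMField, (L →+* ℂ) → Bool)
    (hA : Arapura2012_Cor_15_4_6)
    (W : ∀ {L : CMField} {ι₁ : L →+* ℂ} (V : HermSpace3 L ι₁) (c : SeesawCtx L), WmInput V c.D)
    (μ : ∀ {L : CMField}, SeesawCtx L → Fin 4 → NumberField.InfinitePlace L → ℤ)
    (hR : DeligneMilne1982_Thm_6_20_full)
    (C : CdegSO hHD hI h₁ (cmAbelianVarietyRealised_of_eigenbasis hHD hI h₃') hb hA W μ) :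
    perL_r21AEO_degS hHD hI h₁ h₃' hb hA W μ hR C = perL_r20AEO_degS hHD hI h₁ h₃' hb hA W μ hR C :=
  rfl

/-- **The oriented E closes from the degenerate data EXACTLY modulo the ORIENTED vacuity residual** «no universe
`(L, ι₁)` carries an anisotropic good seesaw context of degree 6 for the model with bit `hb L ι₁`» (stated inline; at a
constant bit it is SAN-15's `NoGoodSextic`, see `perL_r21AEO_const_of_noGoodSextic`). -/
theorem perL_r21AEO_of_noGoodSexticO (h₃' : CMAbelianVarietyEigenbasisRealised)
    (hb : ∀ L : CMField, (L →+* ℂ) → Bool) (hA : Arapura2012_Cor_15_4_6)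
    (W : ∀ {L : CMField} {ι₁ : L →+* ℂ} (V : HermSpace3 L ι₁) (c : SeesawCtx L), WmInput V c.D)
    (μ : ∀ {L : CMField}, SeesawCtx L → Fin 4 → NumberField.InfinitePlace L → ℤ)
    (hR : DeligneMilne1982_Thm_6_20_full)
    (hno : ∀ {L : CMField} {ι₁ : L →+* ℂ} (V : HermSpace3 L ι₁) (c : SeesawCtx L), IsAnisotropic L V.Hm →
      (thetaModelOf hHD hI h₁ (cmAbelianVarietyRealised_of_eigenbasis hHD hI h₃') (hb L ι₁)
        (embOf hHD hI h₁ (cmAbelianVarietyRealised_of_eigenbasis hHD hI h₃'))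
        (coverOf hHD hI h₁ (cmAbelianVarietyRealised_of_eigenbasis hHD hI h₃') hA)
        (wmOfInput fun V c => (W V c).zeroSK)
        (thetaOf _ (thetaClassInputOf _ (fun V c =>
          thetaSpaceInputOf hHD hI h₁ (cmAbelianVarietyRealised_of_eigenbasis hHD hI h₃') degS V c)))
        (d12Of μ) (d34Of μ)).GoodCtx ι₁ c →
      Module.finrank ℚ c.K ≠ 6) :
    (picardCMUniverse hHD hI h₁ (cmAbelianVarietyRealised_of_eigenbasis hHD hI h₃')).PerL :=
  perL_r21AEO_degS hHD hI h₁ h₃' hb hA W μ hR fun V c hV hc h6 => (hno V c hV hc h6).elim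

/-- At a CONSTANT bit the oriented E closes from the degenerate data exactly modulo SAN-15's `NoGoodSextic`
(refuted in kernel by SAN-15b `not_noGoodSextic`): the oriented census specialises to the census of record. -/
theorem perL_r21AEO_const_of_noGoodSextic (h₃' : CMAbelianVarietyEigenbasisRealised) (h : Bool)
    (hA : Arapura2012_Cor_15_4_6)
    (W : ∀ {L : CMField} {ι₁ : L →+* ℂ} (V : HermSpace3 L ι₁) (c : SeesawCtx L), WmInput V c.D)
    (μ : ∀ {L : CMField}, SeesawCtx L → Fin 4 → NumberField.InfinitePlace L → ℤ)
    (hR : DeligneMilne1982_Thm_6_20_full)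
    (hno : NoGoodSextic hHD hI h₁ (cmAbelianVarietyRealised_of_eigenbasis hHD hI h₃') h hA W μ) :
    (picardCMUniverse hHD hI h₁ (cmAbelianVarietyRealised_of_eigenbasis hHD hI h₃')).PerL :=
  perL_r21AEO_of_noGoodSexticO hHD hI h₁ h₃' (fun _ _ => h) hA W μ hR fun V c hV hc => hno V c hV hc

end Sanity
end Model
end HodgeCM

end
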